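import Summits.HodgeConjecture.HodgeConjecture.Theorems.F0P3ClassificationKitV6         -- ★ T5-A V6 p821941 (F0P3-p03 (g6)): `ClassificationKit`, `IsPinned` (10 pins), `EvpData`, `germ`, `Places` (ns `…F0P3InnerFormClassificationV6`)
import Summits.HodgeConjecture.HodgeConjecture.Theorems.F0P3UnrStarAlgebraOfPins          -- ★ p819143 (F0P4-p08 (g6)): the v3.1-kit edition; REUSED: the kit-free `hanis_of_frame`
import Literature.NumberTheory.Automorphic.UnramifiedPureTensorStarCharacter            -- ★ p817782 (F0P4-p08, (L1-iii)): `IrrClass.prod_apply_inv_smul_mulConv` ∕ `prod_apply_mulStar` (+ ★ p817360 `SphericalEigencharacterStarCharacter`)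
import Literature.NumberTheory.Automorphic.LocalUnitaryGroupUnimodularOfAdelic             -- ★ p818298 ED. 2 (F0P4-p08): `UnitaryGroup.isInvInvariant_cmDatum_local_of_anisotropic` (unimodularity of `U(H)(L⁺_v)`, anisotropic `H`)
import HarnessLib

/-!
# T5 law (L1-iii) `UnrStarAlgebra` FOR THE CLASS SUMMAND, FROM THE PINS: the e.v.p.'s of classes are unital `*`-characters of `⊗_{v∉S} 𝓗_v`
## EDITION V6 (over the V6 kit ★ p821941; F0P3-p03 (g6), RULINGS (V36)∕(V37))

Re-cut of ★ p819143 `Theorems/F0P3UnrStarAlgebraOfPins.lean` (F0P4-p08 (g6)) over `Theorems/F0P3ClassificationKitV6.lean` (as ★ p821513 was over the V5 kit):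
the pin tuple has TEN conjuncts (pins (ix) `Kc`-triviality and (x) ramification cofiniteness appended), so the destructuring of `hpin` gains two `-`;
`ramCls c` is `Set`-valued and the unramified-class conditions read `𝔠.ramCls c ⊆ ↑S`; the kit-free `hanis_of_frame` is IMPORTED from the v3.1-kit edition (not
restated); the two kit theorems are re-proved VERBATIM over the V5 kit (statements are those of p819143 with the V6 kit and `⊆ ↑S`).  Namespace `…Cruxes.H413.F0P3UnrStarAlgebraOfPinsV6`.  Original text follows.


Cell `hodgecm-mathlib`, F0∕P3 «U3-mult», crux H413 (`stmt-HodgeConjecture-24833`), RUNG 4 integrator T5 (`F0_T5InnerFormClassification`; ★ T5-A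
`Theorems/F0P3ClassificationKit.lean` = kit + pins), RULINGS (V15)∕(V21)∕(V22)∕09:30:23Z (a); F0P4-p08 (g6) for the F0∕P3 desk.  PROOF lane: no `def`,
no `sorry`, no named fact; `--supports stmt-HodgeConjecture-24833 --as helper`.  Cited BY NAME at T5 v4 (the Lines file stays thin; T5-C byte-frozen).

THE MATHEMATICS [Rogawski1990 §13.7 p. 206; CartierCorvallis1979 §IV.1; Langlands1980 pp. 208–211].  The separation-by-Hecke-eigenvalues argument needs
`⊗_{v∉S} 𝓗_v` (the sockets `Unr S`, `hat S` of the kit, pinned to the restricted tensor product by pins (vii) FACTORISATION and (viii) RICHNESS) to be a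
unital `*`-algebra on which the e.v.p.'s of AUTOMORPHIC origin are `*`-characters (law `UnrStarAlgebra`: products, conjugates and the unit are REALISED by
elements of `Unr S`, uniformly over the germs of automorphic origin).  For the germs of CLASSES `π′` unramified off `S` this is a THEOREM from the pins:
(ii) `clFin c v` is `K_v`-spherical with eigencharacter `evp c v` off `ramCls c`, (iii) `μ_v` Haar, (iv) admissible, (v) unitarizable, (vii), (viii) — and the
one-place analysis ★ p817360 (`t_v(f ⋆ g) = μ_v(K_v) t_v(f) t_v(g)`, `t_v(f^*) = \overline{t_v(f)}` for unitarizable classes on a UNIMODULAR group,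
`t_v(𝟙_{K_v}) = 1`) assembled over finitely many places by ★ p817782.  Unimodularity of `U(H)(L⁺_v)` is ★ p818298 for ANISOTROPIC `H`, and the frame of T5
(`H` definite at every complex place `≠ ι`'s, `[L⁺:ℚ] ≥ 2`) makes `H` anisotropic (`hanis_of_frame`).  The packet summands (`evpG`, `evpH`) of `AutGerm S`
have no local-class anchor in the kit: for them `UnrStarAlgebra` stays a law (as `HatBounded` does, ★ `hatBounded_cls_of_pins`).

* (imported, ★ p819143) `F0P3UnrStarAlgebraOfPins.hanis_of_frame (hdef) (h2) : ∀ x, ShimuraVarieties.hermForm (cmConjRingHom L) H x x = 0 → x = 0` — the frame's `H` is anisotropic (★ `exists_infinitePlace_ne` + ★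
  `anisotropic_of_posDef_map`).
* `unrStarAlgebra_cls_of_pins (𝔠) (hpin : 𝔠.IsPinned) (hanis) (S)` — (1) PRODUCT and (2) STAR for the class summand, (3) UNIT for every germ.
* `unrStarAlgebra_cls_of_frame (𝔠) (hpin) (hdef) (h2) (S)` — the same fed by the frame binders of `shapeGuarded_of_T5` (no new binder surfaces).

References: [Rogawski1990] §13.7 p. 206; [CartierCorvallis1979] §IV.1 Cor. 4.1; [DeitmarEchterhoff2014] Prop. 6.2.1; [Langlands1980] pp. 208–211.
HC_CM is proved only modulo the printed citations until rung 0 closes.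
-/

set_option autoImplicit false
-- project-wide idiom for `Summit.HodgeConjecture.HodgeConjecture.…` (summit = problem name): the namespace IS duplicated
set_option linter.dupNamespace false

noncomputable section

open MeasureTheory NumberField IsDedekindDomain Literature.NumberTheory.Automorphic Literature.NumberTheory.Automorphic.UnitaryGroup
open Summit.HodgeConjecture.HodgeConjecture.Cruxes.H413.F0P3InnerFormClassificationV6
open scoped ComplexConjugate Matrix ComplexOrder

namespace Summit.HodgeConjecture.HodgeConjecture.Cruxes.H413.F0P3UnrStarAlgebraOfPinsV6

/-- **(L1-iii) FOR THE CLASS SUMMAND, FROM THE PINS — the e.v.p.'s of classes are unital `*`-characters of `⊗_{v∉S} 𝓗_v`** [CartierCorvallis1979 §IV.1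
Cor. 4.1; Rogawski1990 §13.7 p. 206; DeitmarEchterhoff2014 Prop. 6.2.1] (RULINGS (V21)∕(V22), F0P3-plan (g4) 09:30:23Z (a): standalone, cited BY NAME at T5 v4): for every `S`,
(1) PRODUCT — for `f^S, g^S ∈ Unr S` there is `h^S ∈ Unr S` with `h^{S∧}(t(π′)) = f^{S∧}(t(π′)) · g^{S∧}(t(π′))` for EVERY class `π′` unramified off `S`;
(2) STAR — for `f^S` there is `g^S` with `g^{S∧}(t(π′)) = \overline{f^{S∧}(t(π′))}` for every such class (unimodular `G′_v`: `hinv`);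
(3) UNIT — there is `u^S` with `u^{S∧}(t) = 1` for EVERY germ `t` (not only classes).
Proof: by pin (vii) `f^{S∧}(t) = ∏_{v ∈ T₁} t_v(f_v)`, `g^{S∧}(t) = ∏_{v ∈ T₂} t_v(g_v)`; pad both families by `𝟙_{K_v}` to all places, form
`h_v := μ_v(K_v)⁻¹ • (f_v ⋆ g_v)` on `T₁ ∪ T₂` (resp. `f_v^*` on `T₁`, resp. the empty family) and realise it in `Unr S` by the richness pin (viii); at
`t = evp c`, `ramCls c ⊆ S`, every `v ∈ T₁ ∪ T₂` is off `ramCls c`, so `clFin c v` is `K_v`-spherical with eigencharacter `t_v` (ii), admissible (iv),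
unitarizable (v), `μ_v` Haar (iii) — and ★ p817782 `IrrClass.prod_apply_inv_smul_mulConv` ∕ `prod_apply_mulStar` (over ★ p817360: `t_v(f ⋆ g) = μ_v(K_v) t_v(f) t_v(g)`,
`t_v(f^*) = \overline{t_v(f)}`, `t_v(𝟙_{K_v}) = 1`) give the identities.  Unimodularity of `U(H)(L⁺_v)` (every Haar `μ_v` inversion-invariant, needed by `f ↦ f^*`)
is ★ p818298 `UnitaryGroup.isInvInvariant_cmDatum_local_of_anisotropic` under the frame's ANISOTROPY binder `hanis` (T1's `IsAnisotropic L H`).  (The packet summands `evpG`, `evpH` of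
`AutGerm` have no local-class anchor in this kit: for them `UnrStarAlgebra` stays a law, exactly as for `HatBounded`.)
[cite: CartierCorvallis1979, §IV.1 Cor. 4.1] [cite: Rogawski1990, §13.7 p. 206] [cite: DeitmarEchterhoff2014, Prop. 6.2.1] -/
theorem unrStarAlgebra_cls_of_pins {L : Type} [Field L] [NumberField L] [IsCMField L] {H : Matrix (Fin 3) (Fin 3) L} {ι : L →+* ℂ} {T : GL (Fin 3) ℂ}
    {hT : (T : Matrix (Fin 3) (Fin 3) ℂ)ᴴ * H.map ι * (T : Matrix (Fin 3) (Fin 3) ℂ) = Literature.Geometry.ComplexHyperbolic.BallModel.J}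
    {μ : Measure (Gp L H).automorphicQuotient} [(Gp L H).IsAutomorphicMeasure μ] (𝔠 : ClassificationKit L H ι T hT μ)
    (hpin : 𝔠.IsPinned)
    (hanis : ∀ x : Fin 3 → L, Literature.AlgebraicGeometry.ShimuraVarieties.hermForm (cmConjRingHom L) H x x = 0 → x = 0)
    (S : Finset (Places L)) :
    (∀ fT gT : 𝔠.Unr S, ∃ hT : 𝔠.Unr S, ∀ c : 𝔠.Cls, 𝔠.ramCls c ⊆ ↑S →
        𝔠.hat S (germ L H S (𝔠.evp c)) hT = 𝔠.hat S (germ L H S (𝔠.evp c)) fT * 𝔠.hat S (germ L H S (𝔠.evp c)) gT) ∧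
    (∀ fT : 𝔠.Unr S, ∃ gT : 𝔠.Unr S, ∀ c : 𝔠.Cls, 𝔠.ramCls c ⊆ ↑S →
        𝔠.hat S (germ L H S (𝔠.evp c)) gT = starRingEnd ℂ (𝔠.hat S (germ L H S (𝔠.evp c)) fT)) ∧
    (∃ uT : 𝔠.Unr S, ∀ t : EvpData L H, 𝔠.hat S (germ L H S t) uT = 1) := by
  classical
  obtain ⟨-, hsph, hhaar, hadm, hunit, -, hhat, hrich, -, -⟩ := hpin
  letI : ∀ v, MeasurableSpace ((cmDatum L 3 H).Local v) := fun v => borel _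
  haveI : ∀ v, BorelSpace ((cmDatum L 3 H).Local v) := fun v => ⟨rfl⟩
  haveI : ∀ v, (𝔠.μv v).IsHaarMeasure := hhaar
  haveI : ∀ v, (𝔠.μv v).IsInvInvariant := fun v => UnitaryGroup.isInvInvariant_cmDatum_local_of_anisotropic L H v hanis (𝔠.μv v)
  have hK := fun v => UnitaryGroup.isCompact_isOpen_cmLocalIntegralLevel L 3 H v
  have hμK : ∀ v, (𝔠.μv v).real (cmLocalIntegralLevel L 3 H v : Set ((cmDatum L 3 H).Local v)) ≠ 0 := fun v => by
    rw [measureReal_def, ENNReal.toReal_ne_zero]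
    exact ⟨((hK v).2.measure_pos (𝔠.μv v) ⟨1, (cmLocalIntegralLevel L 3 H v).one_mem⟩).ne', (hK v).1.measure_lt_top.ne⟩
  -- the unit `𝟙_{K_v}` and padding of a family given on `T` by `𝟙` off `T`
  let one : ∀ v : Places L, (cmDatum L 3 H).Local v → ℂ := fun v =>
    (cmLocalIntegralLevel L 3 H v : Set ((cmDatum L 3 H).Local v)).indicator fun _ => (1 : ℂ)
  have hone : ∀ v, HasCompactSupport (one v) ∧ IsLevel (cmLocalIntegralLevel L 3 H v) (one v) := fun v =>
    ⟨(indicator_mem_schwartzBruhat (hK v).2 (hK v).1).2, IsLevel.indicator (hK v).2 (hK v).1⟩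
  have pad : ∀ (T₀ : Finset (Places L)) (f : ∀ v : Places L, (cmDatum L 3 H).Local v → ℂ),
      (∀ v ∈ T₀, HasCompactSupport (f v) ∧ IsLevel (cmLocalIntegralLevel L 3 H v) (f v)) →
      ∃ F : ∀ v : Places L, (cmDatum L 3 H).Local v → ℂ, (∀ v ∈ T₀, F v = f v) ∧ (∀ v, v ∉ T₀ → F v = one v) ∧
        ∀ v, HasCompactSupport (F v) ∧ IsLevel (cmLocalIntegralLevel L 3 H v) (F v) := by
    intro T₀ f hf
    refine ⟨fun v => if v ∈ T₀ then f v else one v, fun v hv => if_pos hv, fun v hv => if_neg hv, fun v => ?_⟩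
    by_cases hv : v ∈ T₀
    · simp only [hv, ↓reduceIte]; exact hf v hv
    · simp only [hv, ↓reduceIte]; exact hone v
  -- at `t = evp c`, `ramCls c ⊆ ↑S`: the classes off `S`
  have cls : ∀ (c : 𝔠.Cls), 𝔠.ramCls c ⊆ ↑S → ∀ (T₀ : Finset (Places L)), Disjoint T₀ S → ∀ v ∈ T₀,
      (𝔠.clFin c v).IsAdmissible ∧ (𝔠.clFin c v).IsUnitarizable ∧
        (𝔠.clFin c v).IsSphericalWith (cmLocalIntegralLevel L 3 H v) (𝔠.μv v) (𝔠.evp c v) := by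
    intro c hc T₀ hT₀ v hv
    have hvr : v ∉ 𝔠.ramCls c := fun h => Finset.disjoint_left.1 hT₀ hv (Finset.mem_coe.1 (hc h))
    exact ⟨hadm c v hvr, hunit c v hvr, hsph c v hvr⟩
  refine ⟨fun fT gT => ?_, fun fT => ?_, ?_⟩
  · -- (1) PRODUCT
    obtain ⟨T₁, hT₁, f, hf, hfac⟩ := hhat S fT
    obtain ⟨T₂, hT₂, g, hg, hgac⟩ := hhat S gT
    obtain ⟨F, hFT, hFoff, hF⟩ := pad T₁ f hf
    obtain ⟨G, hGT, hGoff, hG⟩ := pad T₂ g hg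
    obtain ⟨hT', hhT'⟩ := hrich S (T₁ ∪ T₂) (Finset.disjoint_union_left.2 ⟨hT₁, hT₂⟩)
      (fun v => (((𝔠.μv v).real (cmLocalIntegralLevel L 3 H v : Set ((cmDatum L 3 H).Local v)) : ℂ)⁻¹) • mulConv (𝔠.μv v) (F v) (G v))
      (fun v _ => ⟨(hasCompactSupport_mulConv (𝔠.μv v) (hF v).1 (hG v).1).smul_left
        (f := fun _ => (((𝔠.μv v).real (cmLocalIntegralLevel L 3 H v : Set ((cmDatum L 3 H).Local v)) : ℂ)⁻¹)),
        ((hF v).2.mulConv (𝔠.μv v) (hG v).2).smul _⟩)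
    refine ⟨hT', fun c hc => ?_⟩
    have hcl := cls c hc (T₁ ∪ T₂) (Finset.disjoint_union_left.2 ⟨hT₁, hT₂⟩)
    have ef : ∏ v ∈ T₁, 𝔠.evp c v (f v) = ∏ v ∈ T₁, 𝔠.evp c v (F v) := Finset.prod_congr rfl fun v hv => by rw [hFT v hv]
    have eg : ∏ v ∈ T₂, 𝔠.evp c v (g v) = ∏ v ∈ T₂, 𝔠.evp c v (G v) := Finset.prod_congr rfl fun v hv => by rw [hGT v hv]
    rw [hhT', hfac, hgac, ef, eg]
    exact IrrClass.prod_apply_inv_smul_mulConv (fun v => cmLocalIntegralLevel L 3 H v) 𝔠.μv (fun v hv => (hcl v hv).1)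
      (fun v hv => (hcl v hv).2.2) (fun v => (hK v).2) (fun v => (hK v).1) hμK (fun v => (hF v).1) (fun v => (hF v).2)
      (fun v => (hG v).1) (fun v => (hG v).2) hFoff hGoff
  · -- (2) STAR
    obtain ⟨T₁, hT₁, f, hf, hfac⟩ := hhat S fT
    obtain ⟨F, hFT, -, hF⟩ := pad T₁ f hf
    obtain ⟨gT', hgT'⟩ := hrich S T₁ hT₁ (fun v => mulStar (F v))
      (fun v _ => ⟨hasCompactSupport_mulStar (hF v).1, (hF v).2.mulStar⟩)
    refine ⟨gT', fun c hc => ?_⟩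
    have hcl := cls c hc T₁ hT₁
    have ef : ∏ v ∈ T₁, 𝔠.evp c v (f v) = ∏ v ∈ T₁, 𝔠.evp c v (F v) := Finset.prod_congr rfl fun v hv => by rw [hFT v hv]
    rw [hgT', hfac, ef]
    exact IrrClass.prod_apply_mulStar (fun v => cmLocalIntegralLevel L 3 H v) 𝔠.μv T₁ (fun v hv => (hcl v hv).1)
      (fun v hv => (hcl v hv).2.1) (fun v hv => (hcl v hv).2.2) hμK (fun v => (hF v).1) (fun v => (hF v).2)
  · -- (3) UNIT
    obtain ⟨uT, huT⟩ := hrich S ∅ (Finset.disjoint_empty_left S) one (fun v _ => hone v)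
    exact ⟨uT, fun t => by rw [huT, Finset.prod_empty]⟩

/-- **(L1-iii) for the class summand, FED BY THE FRAME BINDERS of `shapeGuarded_of_T5`** (`hdef`, `h2` ⇒ `hanis_of_frame`): the form the T5 v4 composition cites
BY NAME. [cite: Rogawski1990, §13.7 p. 206] [cite: CartierCorvallis1979, §IV.1 Cor. 4.1] -/
theorem unrStarAlgebra_cls_of_frame {L : Type} [Field L] [NumberField L] [IsCMField L] {H : Matrix (Fin 3) (Fin 3) L} {ι : L →+* ℂ} {T : GL (Fin 3) ℂ}
    {hT : (T : Matrix (Fin 3) (Fin 3) ℂ)ᴴ * H.map ι * (T : Matrix (Fin 3) (Fin 3) ℂ) = Literature.Geometry.ComplexHyperbolic.BallModel.J}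
    {μ : Measure (Gp L H).automorphicQuotient} [(Gp L H).IsAutomorphicMeasure μ] (𝔠 : ClassificationKit L H ι T hT μ) (hpin : 𝔠.IsPinned)
    (hdef : ∀ τ' : L →+* ℂ, InfinitePlace.mk τ' ≠ InfinitePlace.mk ι → (H.map τ').PosDef) (h2 : 2 ≤ Module.finrank ℚ ↥(maximalRealSubfield L))
    (S : Finset (Places L)) :
    (∀ fT gT : 𝔠.Unr S, ∃ hT : 𝔠.Unr S, ∀ c : 𝔠.Cls, 𝔠.ramCls c ⊆ ↑S →
        𝔠.hat S (germ L H S (𝔠.evp c)) hT = 𝔠.hat S (germ L H S (𝔠.evp c)) fT * 𝔠.hat S (germ L H S (𝔠.evp c)) gT) ∧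
    (∀ fT : 𝔠.Unr S, ∃ gT : 𝔠.Unr S, ∀ c : 𝔠.Cls, 𝔠.ramCls c ⊆ ↑S →
        𝔠.hat S (germ L H S (𝔠.evp c)) gT = starRingEnd ℂ (𝔠.hat S (germ L H S (𝔠.evp c)) fT)) ∧
    (∃ uT : 𝔠.Unr S, ∀ t : EvpData L H, 𝔠.hat S (germ L H S t) uT = 1) :=
  unrStarAlgebra_cls_of_pins 𝔠 hpin (F0P3UnrStarAlgebraOfPins.hanis_of_frame hdef h2) S

end Summit.HodgeConjecture.HodgeConjecture.Cruxes.H413.F0P3UnrStarAlgebraOfPinsV6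

end
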